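import Mathlib
import HarnessLib
import Literature.Analysis.Complex.SeparatelyHolomorphicStrips

/-!
# Paley–Wiener for Fourier series: coefficients of a `2π`-periodic function analytic in a strip

Auxiliary file for sub-stub `stub_slabModeExpDecay_auxPaleyWiener` of line
`self-energy-pick-inversion`.

Crux `PrecisionLaplacian.DirectCorrelationStableTail` (stmt-CriticalPhenomena-4799), parent stub
`stub_slabModeExpDecay` (the transverse mass gap).  This file is the abstract one-dimensional
harmonic-analysis input: let `Ψ` be holomorphic on the open strip `S_b = {|Im z| < b}` and
`2π`-periodic on the real axis.  Then

* `Ψ` is `2π`-periodic on the whole strip (identity theorem from the real axis,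
  `apply_add_two_pi_of_strip`, `apply_add_int_mul_two_pi_of_strip`), hence bounded on every closed
  sub-strip `{|Im z| ≤ y}`, `y < b` (`exists_norm_le_of_strip`);
* the exponential coefficient integral may be shifted to any horizontal line of the strip:
  `∫_{-π}^{π} Ψ(θ) e^{imθ} dθ = ∫_{-π}^{π} Ψ(θ + iy) e^{im(θ+iy)} dθ`, `|y| < b`, `m ∈ ℤ`
  (Cauchy–Goursat on the rectangle `[-π, π] × [0, y]`, Mathlib's
  `Complex.integral_boundary_rect_eq_zero_of_differentiableOn`; the vertical sides cancel by
  periodicity) (`integral_mul_exp_eq_integral_shift`);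
* hence `‖∫_{-π}^{π} Ψ(θ) e^{imθ} dθ‖ ≤ 2π M e^{-my}` if `‖Ψ‖ ≤ M` on the line `Im z = y`
  (`norm_integral_mul_exp_le_of_strip`), and for the cosine coefficients
  `‖∫_{-π}^{π} Ψ(θ) cos(nθ) dθ‖ ≤ 2π M e^{-ny}` if `‖Ψ‖ ≤ M` on `{|Im z| ≤ y}`, `0 ≤ y < b`
  (`norm_integral_mul_cos_le_of_strip`; shift `e^{inθ}` up and `e^{-inθ}` down);
* the real form for the trace `f = Ψ|_ℝ` of a real-valued periodic function
  (`abs_integral_mul_cos_le_of_strip`, registered as `stub_slabModeExpDecay_auxPaleyWiener2`):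
  `|∫_{-π}^{π} f(θ) cos(nθ) dθ| ≤ 2π M e^{-ny}` — the Fourier coefficients of a periodic function
  with a bounded analytic continuation to a strip of half-width `b` decay like `e^{-ny}` for every
  `y < b`.

Pure theorem file, no definitions.  Sources: folklore (Paley–Wiener for Fourier series);
Y. Katznelson, *An Introduction to Harmonic Analysis*, I.4; the tree's
`Literature/Analysis/Complex/PeriodicEntireFourier.lean` (the `2πi`-periodic entire case) and
`Literature.Analysis.Complex.eqOn_setOf_abs_im_lt_of_forall_ofReal` (identity theorem on a strip).
-/

noncomputable section

namespace Summit.CriticalPhenomena.Ising3DConformalLimit.Cruxes.DirectCorrelationStableTail.SelfEnergyPickInversion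

open MeasureTheory Filter Topology Complex
open scoped BigOperators Real

/-! ### Periodicity propagates from the real axis to the strip -/

/-- **Periodicity on the strip.** A function holomorphic on `{|Im z| < b}` and `2π`-periodic on the
real axis is `2π`-periodic on the strip (identity theorem for `z ↦ Ψ(z + 2π)` and `Ψ`). [folklore] -/
theorem apply_add_two_pi_of_strip {Ψ : ℂ → ℂ} {b : ℝ} (hb : 0 < b)
    (hΨ : DifferentiableOn ℂ Ψ {z : ℂ | |z.im| < b}) (hper : ∀ θ : ℝ, Ψ (θ + 2 * π) = Ψ θ)
    {z : ℂ} (hz : |z.im| < b) : Ψ (z + 2 * π) = Ψ z := by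
  have hmaps : Set.MapsTo (fun z : ℂ => z + 2 * π) {z : ℂ | |z.im| < b} {z : ℂ | |z.im| < b} := by
    intro w hw
    simpa using hw
  have hd : DifferentiableOn ℂ (fun z : ℂ => Ψ (z + 2 * π)) {z : ℂ | |z.im| < b} :=
    hΨ.comp (differentiableOn_id.add_const _) hmaps
  have h := Literature.Analysis.Complex.eqOn_setOf_abs_im_lt_of_forall_ofReal hb hd hΨ
    (fun t => hper t)
  exact h hz

/-- **Iterated periodicity on the strip**: `Ψ(z + 2πm) = Ψ(z)` for `m ∈ ℤ` and `|Im z| < b`. [folklore] -/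
theorem apply_add_int_mul_two_pi_of_strip {Ψ : ℂ → ℂ} {b : ℝ} (hb : 0 < b)
    (hΨ : DifferentiableOn ℂ Ψ {z : ℂ | |z.im| < b}) (hper : ∀ θ : ℝ, Ψ (θ + 2 * π) = Ψ θ)
    (m : ℤ) {z : ℂ} (hz : |z.im| < b) : Ψ (z + m * (2 * π)) = Ψ z := by
  induction m using Int.induction_on with
  | zero => simp
  | succ j hj =>
    push_cast at hj ⊢
    have hz' : |(z + (j : ℂ) * (2 * π)).im| < b := by simpa using hz
    have h := apply_add_two_pi_of_strip hb hΨ hper hz'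
    rw [show z + ((j : ℂ) + 1) * (2 * π) = z + (j : ℂ) * (2 * π) + 2 * π by ring, h, hj]
  | pred j hj =>
    push_cast at hj ⊢
    have hz' : |(z + (-(j : ℂ) - 1) * (2 * π)).im| < b := by simpa using hz
    have h := apply_add_two_pi_of_strip hb hΨ hper hz'
    rw [show z + (-(j : ℂ) - 1) * (2 * π) + 2 * π = z + (-(j : ℂ)) * (2 * π) by ring] at h
    rw [h] at hj
    exact hj

/-- **Boundedness on closed sub-strips.** A function holomorphic on `{|Im z| < b}` and `2π`-periodic
on `ℝ` is bounded on every closed sub-strip `{|Im z| ≤ y}`, `y < b` (it is periodic on the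
strip, and continuous on the compact period rectangle `[-π, π] × [-y, y]`). [folklore] -/
theorem exists_norm_le_of_strip {Ψ : ℂ → ℂ} {b : ℝ} (hb : 0 < b)
    (hΨ : DifferentiableOn ℂ Ψ {z : ℂ | |z.im| < b}) (hper : ∀ θ : ℝ, Ψ (θ + 2 * π) = Ψ θ)
    {y : ℝ} (hy : y < b) : ∃ M : ℝ, ∀ z : ℂ, |z.im| ≤ y → ‖Ψ z‖ ≤ M := by
  -- the compact period rectangle lies in the strip
  have hK : IsCompact (Set.Icc (-π) π ×ℂ Set.Icc (-y) y) :=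
    Metric.isCompact_of_isClosed_isBounded (isClosed_Icc.reProdIm isClosed_Icc)
      ((Metric.isBounded_Icc (-π) π).reProdIm (Metric.isBounded_Icc (-y) y))
  have hKsub : Set.Icc (-π) π ×ℂ Set.Icc (-y) y ⊆ {z : ℂ | |z.im| < b} := by
    intro z hz
    have h2 : z.im ∈ Set.Icc (-y) y := (Complex.mem_reProdIm.1 hz).2
    show |z.im| < b
    rw [abs_lt]
    constructor <;> linarith [h2.1, h2.2]
  obtain ⟨M, hM⟩ := hK.exists_bound_of_continuousOn (hΨ.continuousOn.mono hKsub)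
  refine ⟨M, fun z hz => ?_⟩
  -- reduce `Re z` modulo `2π` into `[-π, π)`
  set m : ℤ := toIcoDiv Real.two_pi_pos (-π) z.re with hm
  have hmem : z.re - m • (2 * π) ∈ Set.Ico (-π) (-π + 2 * π) := by
    rw [hm, self_sub_toIcoDiv_zsmul]
    exact toIcoMod_mem_Ico _ _ _
  have hzb : |z.im| < b := lt_of_le_of_lt hz hy
  have hwim : (z + ((-m : ℤ) : ℂ) * (2 * π)).im = z.im := by simp
  have hwre : (z + ((-m : ℤ) : ℂ) * (2 * π)).re = z.re - m • (2 * π) := by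
    simp [zsmul_eq_mul]
    ring
  have hwz : Ψ z = Ψ (z + ((-m : ℤ) : ℂ) * (2 * π)) := by
    have h := apply_add_int_mul_two_pi_of_strip hb hΨ hper m (z := z + ((-m : ℤ) : ℂ) * (2 * π))
      (by rw [hwim]; exact hzb)
    rw [← h]
    congr 1
    push_cast
    ring
  rw [hwz]
  refine hM _ (Complex.mem_reProdIm.2 ⟨?_, ?_⟩)
  · rw [hwre]
    exact ⟨hmem.1, by linarith [hmem.2]⟩
  · rw [hwim]
    exact abs_le.1 hz

/-! ### Shifting the coefficient integral to a horizontal line of the strip -/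

/-- **Contour shift.** For `Ψ` holomorphic on `{|Im z| < b}` and `2π`-periodic on `ℝ`, `m ∈ ℤ` and
`|y| < b`: `∫_{-π}^{π} Ψ(θ) e^{imθ} dθ = ∫_{-π}^{π} Ψ(θ + iy) e^{im(θ + iy)} dθ` (Cauchy–Goursat on
the rectangle `[-π, π] × [0, y]`; the vertical sides cancel by periodicity). [folklore] -/
theorem integral_mul_exp_eq_integral_shift {Ψ : ℂ → ℂ} {b : ℝ} (hb : 0 < b)
    (hΨ : DifferentiableOn ℂ Ψ {z : ℂ | |z.im| < b}) (hper : ∀ θ : ℝ, Ψ (θ + 2 * π) = Ψ θ)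
    (m : ℤ) {y : ℝ} (hy : |y| < b) :
    (∫ θ in (-π : ℝ)..π, Ψ θ * Complex.exp (m * θ * I)) =
      ∫ θ in (-π : ℝ)..π, Ψ (θ + y * I) * Complex.exp (m * (θ + y * I) * I) := by
  set g : ℂ → ℂ := fun w => Ψ w * Complex.exp (m * w * I) with hg
  -- `g` is holomorphic on the strip and `2π`-periodic there
  have hgd : DifferentiableOn ℂ g {z : ℂ | |z.im| < b} := by
    rw [hg]
    exact hΨ.mul (by fun_prop)
  have hgper : ∀ w : ℂ, |w.im| < b → g (w + 2 * π) = g w := by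
    intro w hw
    simp only [hg]
    rw [apply_add_two_pi_of_strip hb hΨ hper hw]
    congr 1
    rw [show (m : ℂ) * (w + 2 * π) * I = m * w * I + m * (2 * π * I) by ring, Complex.exp_add,
      Complex.exp_int_mul_two_pi_mul_I, mul_one]
  -- the closed rectangle `[-π, π] × [0, y]` lies in the strip
  have hrect : Set.uIcc (-π) π ×ℂ Set.uIcc 0 y ⊆ {z : ℂ | |z.im| < b} := by
    intro z hz
    have h2 : z.im ∈ Set.uIcc 0 y := hz.2
    rw [Set.mem_uIcc] at h2
    show |z.im| < b
    rw [abs_lt] at hy ⊢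
    rcases h2 with ⟨h2a, h2b⟩ | ⟨h2a, h2b⟩ <;> constructor <;> linarith
  have h := Complex.integral_boundary_rect_eq_zero_of_differentiableOn g ((-π : ℝ) : ℂ) (π + y * I)
    (hgd.mono (by simpa using hrect))
  have hre1 : (((-π : ℝ) : ℂ)).re = -π := Complex.ofReal_re _
  have him1 : (((-π : ℝ) : ℂ)).im = 0 := Complex.ofReal_im _
  have hre2 : ((π : ℂ) + y * I).re = π := by simp
  have him2 : ((π : ℂ) + y * I).im = y := by simp
  rw [hre1, him1, hre2, him2] at h
  -- the vertical sides cancel by periodicity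
  have hvert : (∫ t : ℝ in (0 : ℝ)..y, g (π + t * I)) =
      ∫ t : ℝ in (0 : ℝ)..y, g (((-π : ℝ) : ℂ) + t * I) := by
    refine intervalIntegral.integral_congr fun t ht => ?_
    have him : ((((-π : ℝ) : ℂ)) + t * I).im = t := by simp
    have htb : |((((-π : ℝ) : ℂ)) + t * I).im| < b := by
      rw [him]
      rw [Set.mem_uIcc] at ht
      rw [abs_lt] at hy ⊢
      rcases ht with ⟨h2a, h2b⟩ | ⟨h2a, h2b⟩ <;> constructor <;> linarith
    have := hgper _ htb
    rw [← this]
    congr 1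
    push_cast
    ring
  rw [hvert, add_sub_assoc, sub_self, add_zero, sub_eq_zero] at h
  simpa [hg] using h

/-- **Exponential coefficient bound.** If moreover `‖Ψ(θ + iy)‖ ≤ M` for real `θ`, then
`‖∫_{-π}^{π} Ψ(θ) e^{imθ} dθ‖ ≤ 2π M e^{-my}` (on the shifted line `|e^{im(θ+iy)}| = e^{-my}`).
[folklore] -/
theorem norm_integral_mul_exp_le_of_strip {Ψ : ℂ → ℂ} {b : ℝ} (hb : 0 < b)
    (hΨ : DifferentiableOn ℂ Ψ {z : ℂ | |z.im| < b}) (hper : ∀ θ : ℝ, Ψ (θ + 2 * π) = Ψ θ)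
    (m : ℤ) {y M : ℝ} (hy : |y| < b) (hM : ∀ θ : ℝ, ‖Ψ (θ + y * I)‖ ≤ M) :
    ‖∫ θ in (-π : ℝ)..π, Ψ θ * Complex.exp (m * θ * I)‖ ≤ 2 * π * M * Real.exp (-(m * y)) := by
  rw [integral_mul_exp_eq_integral_shift hb hΨ hper m hy]
  have hbound : ‖∫ θ in (-π : ℝ)..π, Ψ (θ + y * I) * Complex.exp (m * (θ + y * I) * I)‖ ≤
      M * Real.exp (-(m * y)) * |π - (-π)| := by
    refine intervalIntegral.norm_integral_le_of_norm_le_const fun θ _ => ?_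
    rw [norm_mul, Complex.norm_exp]
    have hre : ((m : ℂ) * (θ + y * I) * I).re = -(m * y) := by
      simp [mul_re, mul_im]
    rw [hre]
    exact mul_le_mul_of_nonneg_right (hM θ) (Real.exp_pos _).le
  calc ‖∫ θ in (-π : ℝ)..π, Ψ (θ + y * I) * Complex.exp (m * (θ + y * I) * I)‖
      ≤ M * Real.exp (-(m * y)) * |π - (-π)| := hbound
    _ = 2 * π * M * Real.exp (-(m * y)) := by
        rw [sub_neg_eq_add, abs_of_pos (by positivity)]
        ring

/-! ### Cosine coefficients -/

/-- The trace on `ℝ` of a function holomorphic on the strip is continuous. [folklore] -/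
theorem continuous_ofReal_comp_of_strip {Ψ : ℂ → ℂ} {b : ℝ} (hb : 0 < b)
    (hΨ : DifferentiableOn ℂ Ψ {z : ℂ | |z.im| < b}) : Continuous fun θ : ℝ => Ψ θ :=
  hΨ.continuousOn.comp_continuous Complex.continuous_ofReal fun θ => by simpa using hb

/-- **Cosine coefficient bound.** For `Ψ` holomorphic on `{|Im z| < b}`, `2π`-periodic on `ℝ` and
bounded by `M` on the closed sub-strip `{|Im z| ≤ y}`, `0 ≤ y < b`, and `n ∈ ℕ`:
`‖∫_{-π}^{π} Ψ(θ) cos(nθ) dθ‖ ≤ 2π M e^{-ny}` (write `2cos(nθ) = e^{inθ} + e^{-inθ}` and shift the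
first integral to `Im z = y`, the second to `Im z = -y`). [folklore] -/
theorem norm_integral_mul_cos_le_of_strip {Ψ : ℂ → ℂ} {b : ℝ} (hb : 0 < b)
    (hΨ : DifferentiableOn ℂ Ψ {z : ℂ | |z.im| < b}) (hper : ∀ θ : ℝ, Ψ (θ + 2 * π) = Ψ θ)
    (n : ℕ) {y M : ℝ} (hy0 : 0 ≤ y) (hy : y < b) (hM : ∀ z : ℂ, |z.im| ≤ y → ‖Ψ z‖ ≤ M) :
    ‖∫ θ in (-π : ℝ)..π, Ψ θ * Complex.cos (n * θ)‖ ≤ 2 * π * M * Real.exp (-(n * y)) := by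
  have hcont : Continuous fun θ : ℝ => Ψ θ := continuous_ofReal_comp_of_strip hb hΨ
  have hy1 : |y| < b := by rwa [abs_of_nonneg hy0]
  have hy2 : |(-y)| < b := by rwa [abs_neg, abs_of_nonneg hy0]
  -- the two exponential pieces, shifted up resp. down
  have h1 : ‖∫ θ in (-π : ℝ)..π, Ψ θ * Complex.exp (n * θ * I)‖ ≤ 2 * π * M * Real.exp (-(n * y)) := by
    have := norm_integral_mul_exp_le_of_strip hb hΨ hper (n : ℤ) hy1 (M := M) fun θ => hM _ (by
      simp [abs_of_nonneg hy0])
    simpa using this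
  have h2 : ‖∫ θ in (-π : ℝ)..π, Ψ θ * Complex.exp (-(n * θ * I))‖ ≤
      2 * π * M * Real.exp (-(n * y)) := by
    have := norm_integral_mul_exp_le_of_strip hb hΨ hper (-(n : ℤ)) hy2 (M := M) fun θ => hM _ (by
      simp [abs_of_nonneg hy0])
    simpa using this
  -- `2 cos(nθ) = e^{inθ} + e^{-inθ}`
  have hpt : ∀ θ : ℝ, Ψ θ * Complex.cos (n * θ) =
      (1 / 2 : ℂ) * (Ψ θ * Complex.exp (n * θ * I) + Ψ θ * Complex.exp (-(n * θ * I))) := by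
    intro θ
    have h2c := Complex.two_cos (n * θ)
    rw [neg_mul] at h2c
    rw [← mul_add, ← h2c]
    ring
  have hi1 : IntervalIntegrable (fun θ : ℝ => Ψ θ * Complex.exp (n * θ * I)) volume (-π) π :=
    (hcont.mul (by fun_prop)).intervalIntegrable _ _
  have hi2 : IntervalIntegrable (fun θ : ℝ => Ψ θ * Complex.exp (-(n * θ * I))) volume (-π) π :=
    (hcont.mul (by fun_prop)).intervalIntegrable _ _
  have hsplit : (∫ θ in (-π : ℝ)..π, Ψ θ * Complex.cos (n * θ)) =
      (1 / 2 : ℂ) * ((∫ θ in (-π : ℝ)..π, Ψ θ * Complex.exp (n * θ * I)) +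
        ∫ θ in (-π : ℝ)..π, Ψ θ * Complex.exp (-(n * θ * I))) := by
    rw [← intervalIntegral.integral_add hi1 hi2, ← intervalIntegral.integral_const_mul]
    exact intervalIntegral.integral_congr fun θ _ => hpt θ
  have hhalf : ‖(1 / 2 : ℂ)‖ = 1 / 2 := by
    rw [norm_div, norm_one, Complex.norm_two]
  rw [hsplit, norm_mul, hhalf]
  calc 1 / 2 * ‖(∫ θ in (-π : ℝ)..π, Ψ θ * Complex.exp (n * θ * I)) +
        ∫ θ in (-π : ℝ)..π, Ψ θ * Complex.exp (-(n * θ * I))‖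
      ≤ 1 / 2 * (2 * π * M * Real.exp (-(n * y)) + 2 * π * M * Real.exp (-(n * y))) :=
        mul_le_mul_of_nonneg_left ((norm_add_le _ _).trans (add_le_add h1 h2)) (by norm_num)
    _ = 2 * π * M * Real.exp (-(n * y)) := by ring

/-- **Real form: exponential decay of the Fourier coefficients.**  Let `f : ℝ → ℝ` be `2π`-periodic
and the trace of a function `Ψ` holomorphic on `{|Im z| < b}` which is bounded by `M` on
`{|Im z| ≤ y}`, `0 ≤ y < b`.  Then `|∫_{-π}^{π} f(θ) cos(nθ) dθ| ≤ 2π M e^{-ny}` for every `n ∈ ℕ`.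
[folklore] -/
theorem abs_integral_mul_cos_le_of_strip {f : ℝ → ℝ} {Ψ : ℂ → ℂ} {b : ℝ} (hb : 0 < b)
    (hΨ : DifferentiableOn ℂ Ψ {z : ℂ | |z.im| < b}) (htrace : ∀ θ : ℝ, Ψ θ = (f θ : ℂ))
    (hper : ∀ θ : ℝ, f (θ + 2 * π) = f θ) (n : ℕ) {y M : ℝ} (hy0 : 0 ≤ y) (hy : y < b)
    (hM : ∀ z : ℂ, |z.im| ≤ y → ‖Ψ z‖ ≤ M) :
    |∫ θ in (-π : ℝ)..π, f θ * Real.cos (n * θ)| ≤ 2 * π * M * Real.exp (-(n * y)) := by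
  have hperΨ : ∀ θ : ℝ, Ψ (θ + 2 * π) = Ψ θ := fun θ => by
    have := htrace (θ + 2 * π)
    push_cast at this
    rw [this, hper, htrace]
  have h := norm_integral_mul_cos_le_of_strip hb hΨ hperΨ n hy0 hy hM
  have heq : (∫ θ in (-π : ℝ)..π, Ψ θ * Complex.cos (n * θ)) =
      ((∫ θ in (-π : ℝ)..π, f θ * Real.cos (n * θ) : ℝ) : ℂ) := by
    rw [← intervalIntegral.integral_ofReal]
    refine intervalIntegral.integral_congr fun θ _ => ?_
    simp only [htrace]
    push_cast
    ring
  rwa [heq, Complex.norm_real, Real.norm_eq_abs] at h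

/-- **Registered auxiliary stub `stub_slabModeExpDecay_auxPaleyWiener2`** (brick of
`stub_slabModeExpDecay`, Paley–Wiener half): the Fourier cosine coefficients of a real `2π`-periodic
function admitting a bounded holomorphic extension to the strip `{|Im z| < b}` decay like `e^{-ny}`
for every `y < b` (`abs_integral_mul_cos_le_of_strip`). [folklore] -/
theorem stub_slabModeExpDecay_auxPaleyWiener2 : ∀ (f : ℝ → ℝ) (Ψ : ℂ → ℂ) (b y M : ℝ) (n : ℕ),
    0 < b → DifferentiableOn ℂ Ψ {z : ℂ | |z.im| < b} → (∀ θ : ℝ, Ψ θ = (f θ : ℂ)) →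
    (∀ θ : ℝ, f (θ + 2 * Real.pi) = f θ) → 0 ≤ y → y < b → (∀ z : ℂ, |z.im| ≤ y → ‖Ψ z‖ ≤ M) →
    |∫ θ in (-Real.pi)..Real.pi, f θ * Real.cos (n * θ)| ≤
      2 * Real.pi * M * Real.exp (-(n * y)) :=
  fun _ _ _ _ _ n hb hΨ htrace hper hy0 hy hM =>
    abs_integral_mul_cos_le_of_strip hb hΨ htrace hper n hy0 hy hM

end Summit.CriticalPhenomena.Ising3DConformalLimit.Cruxes.DirectCorrelationStableTail.SelfEnergyPickInversion

end
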